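import Literature.AlgebraicGeometry.ModuliOfAbelianVarieties.SiegelLinearRigidificationBaseChange
import Literature.AlgebraicGeometry.ModuliOfAbelianVarieties.SiegelFramedCovariant
import Literature.AlgebraicGeometry.ModuliOfAbelianVarieties.SiegelModuliOfOpenCharts
import Literature.AlgebraicGeometry.ModuliOfAbelianVarieties.SiegelModuliFrameSubfunctor
import Literature.AlgebraicGeometry.ModuliOfAbelianVarieties.SiegelLinearRigidificationAct
import Literature.AlgebraicGeometry.ModuliOfAbelianVarieties.SiegelLinearRigidificationUnique
import Literature.AlgebraicGeometry.Morphisms.ProjectiveFrameStandardPosition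
import Literature.AlgebraicGeometry.Morphisms.ProjectiveFrameLocusLinearInvariance
import Literature.AlgebraicGeometry.Morphisms.ProjectiveFrameSlice
import Literature.AlgebraicGeometry.AbelianSchemes.PolarizedAbelianSchemeWithLevelBaseChangeCancel
import Literature.AlgebraicGeometry.AbelianSchemes.PolarizedTripleIsBaseChangeViaZariskiGlue
import Literature.AlgebraicGeometry.AbelianSchemes.PolarizedTripleRigidityDescent
import HarnessLib

/-!
# The standard-frame slice `V_R ⊂ H` represents the frame sub-functor `𝓕_R` (MFK Prop. 7.6, local step)

[MumfordFogartyKirwan1994, Ch. 7 §2 Prop. 7.6 (pp. 136–138)] proves that the moduli functor `𝒜_{g,d,n}` of polarised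
abelian schemes with level structure is covered by open sub-functors `𝓕_R` («the `R`-marked torsion points are a
projective frame everywhere», ★ `PolarizedAbelianSchemeWithLevel.IsFrameOn`), each represented by a locally closed
sub-scheme of the framed covariant `H` of Prop. 7.3/7.6: MFK's `σ_R⁻¹(standard frame) ⊂ U_R` of
[MumfordFogartyKirwan1994, Ch. 3 §1 Prop. 3.1] — the locus `V_R` where the `R`-marked points of the universal
rigidified triple ARE the fundamental frame.  This file proves that representability statement, in the currency of
★ `SiegelFramedCovariant` (the covariant `H` with its universal linearly rigidified triple, (8α)) and of
★ `SiegelFineModuliScheme.classify_of_openCharts` (whose hypothesis `hrep` is exactly `sliceRepresents_slice` below).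

The slice enters §§1–3 and §5 through its functor of points only — binders `(V) (jV : V ⟶ H) [Mono jV]` and
`hV : (∃ y, y ≫ jV = x) ↔ «the R-marked points of x : T' → H are in standard position»` — and §4 instantiates them
at the concrete equaliser ★ `ProjFrame.slice` inside the basic open `W_R = H_{D(R)}` of the frame determinant.

* §1 `sliceRepresents_local`: a linearly rigidified triple whose `R`-marked points are a unit frame in one chart
  choice is classified by the slice — move the rigidification by the inverse transporter `g⁻¹ ∈ GL_{m+1}(Γ(S, 𝒪))`
  (★ `IsLinearRigidification.lift_actCore`, ★ `topCoord_lift_actCore_transporterGL_inv`), classify by `represents`.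
* §2 `sliceRepresents_unique`: two such classifying morphisms agree — the two rigidifications differ locally by some
  `M ∈ GL_{m+1}` (★ `exists_openCover_GL_of_isLinearRigidification`, B-p01 (g14); MFK p. 131) fixing the standard position,
  so `M` is scalar (★ `exists_eq_scalar_of_topCoord_lift_actCore_eq_fundamentalFrame`) and acts trivially.
* §3 `exists_nhd_isBaseChangeVia_slice`, `sliceRepresents`: Zariski-local existence from `IsFrameOn`, gluing of the
  local morphisms (Mathlib `Scheme.Cover.glueMorphisms`) and of the relation (★ `exists_isBaseChangeVia_of_openCover`,
  field rigidity ★ `eq_id_and_hat_eq_id_of_three_le` — here `3 ≤ N` and the `ℚ`-structure enter).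
* §4 `exists_comp_sliceι_eq_iff`, `isLocallyNoetherian_slice`, `sliceRepresents_slice`: the concrete slice.
* §5 `isFrameOn_univ_baseChange(_slice)`: `univ|_{V_R} ∈ 𝓕_R(V_R)` (the `huniv` input of the (8ε) assembly).

PROOF lane: theorems only (no `def`, no instance, no notation, no `sorry`).  Cell hodgecm-mathlib, F-8 path (8γ-E);
B-p04 (g20), with CUT A ★ `Morphisms/ProjectiveFrameStandardPosition` (B-p12 (g16)), LR-ACT ★
`SiegelLinearRigidificationAct` (B-p07 (g18)), (8β-b) ★ `SiegelModuliFrameSubfunctor` (B-typ04 (g13)/B-p11 (g17)).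

## Sources
* [MumfordFogartyKirwan1994] D. Mumford, J. Fogarty, F. Kirwan, *Geometric Invariant Theory*, 3rd ed., Ergebnisse 34,
  Springer (1994): Ch. 7 §2 Definition 7.2 (p. 129), Proposition 7.6 (p. 136; proof pp. 136–138); Ch. 3 §1
  Definition 3.3 (p. 68), Proposition 3.1 (pp. 68–69).
* [GortzWedhorn2020] U. Görtz, T. Wedhorn, *Algebraic Geometry I: Schemes*, 2nd ed. (2020): Definition 4.44 (p. 117)
  (the action of `GL_{n+1}` on `𝐏ⁿ(T)`), (11.15.1).
* [Hartshorne1977] R. Hartshorne, *Algebraic Geometry*, GTM 52 (1977): II Thm. 7.1 (a) (p. 150) (`T`-points of `𝐏ⁿ`).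
-/

noncomputable section

set_option backward.isDefEq.respectTransparency false

open CategoryTheory CategoryTheory.Limits AlgebraicGeometry Matrix TopologicalSpace
open Literature.AlgebraicGeometry.Morphisms (intU projectiveSpaceInt isPullback_projToSpec_projMap_terminal)
open Literature.AlgebraicGeometry.Morphisms.ProjFrame (frameLocus preimage_frameLocus comp_lift_actCore topCoord
  preU_comp_eq_top preU_lift_actCore_tuple mem_frameLocus_iff frameDetSection preU_ι_comp_eq_top
  basicOpen_frameDetSection_le_chartOpen isUnitFrame_topCoord_basicOpen slice sliceι comp_sliceι_factors_iff
  preimage_basicOpen_frameDetSection frameLocus_eq_basicOpen frameLocus_eq_top_iff_isUnitFrame topCoord_congr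
  topCoord_lift_actCore_transporterGL_inv exists_eq_scalar_of_topCoord_lift_actCore_eq_fundamentalFrame
  lift_actCore_eq_self_of_eq_scalar)
open Literature.AlgebraicGeometry.ProjectiveSpace.ProjFrame (IsUnitFrame fundamentalFrame stdChart transporterGL
  isUnitFrame_fundamentalFrame)
open Literature.AlgebraicGeometry.GroupSchemes.GeneralLinearGroupScheme (intCast actCore)
open Literature.AlgebraicGeometry.Motives.GeneratingSections
open Literature.AlgebraicGeometry.Motives (SchemeOver)
open Literature.AlgebraicGeometry.AbelianSchemes Literature.AlgebraicGeometry.AbelianSchemes.PolarizedAbelianSchemeWithLevel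



namespace Literature.AlgebraicGeometry.ModuliOfAbelianVarieties

namespace SiegelFramedCovariant

variable {g N : ℕ} {δ : Fin g → ℕ} {J : Type} (𝓗 : SiegelFramedCovariant g N δ J)

section Generic

variable (hN : 3 ≤ N)
  (R : Fin (Nat.card J + 2) → (Fin g ⊕ Fin g → ZMod N))
  (V : Scheme.{0}) (jV : V ⟶ 𝓗.H.left) [Mono jV]
  (hV : ∀ ⦃T' : Scheme.{0}⦄ (x : T' ⟶ 𝓗.H.left), (∃ y : T' ⟶ V, y ≫ jV = x) ↔
    ∃ hx : ∀ j, preU (x ≫ 𝓗.markedPoint (R j)) (stdChart (Nat.card J) j) = ⊤,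
      topCoord (fun j => x ≫ 𝓗.markedPoint (R j)) (stdChart (Nat.card J)) hx =
        fundamentalFrame (Nat.card J) Γ(T', ⊤))


omit [Mono jV] in
include hV in
/-- A `T'`-point of `V` has its `R`-marked points in standard position after any further pull-back `x : T'' → T'`
(`hV` forward, then ★ `mapTuple_topCoord` + `mapTuple_fundamentalFrame`). [cite: MumfordFogartyKirwan1994, Ch. 3 §1 Proposition 3.1] -/
theorem exists_topCoord_comp_eq_fundamentalFrame {T' T'' : Scheme.{0}} (y : T' ⟶ V) (x : T'' ⟶ T') :
    ∃ hx : ∀ j, preU ((x ≫ y ≫ jV) ≫ 𝓗.markedPoint (R j)) (stdChart (Nat.card J) j) = ⊤,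
      topCoord (fun j => (x ≫ y ≫ jV) ≫ 𝓗.markedPoint (R j)) (stdChart (Nat.card J)) hx =
        fundamentalFrame (Nat.card J) Γ(T'', ⊤) :=
  (hV (x ≫ y ≫ jV)).mp ⟨x ≫ y, by rw [Category.assoc]⟩

omit [Mono jV] in
/-- Transport of «standard position» along an equality of tuples (proof-irrelevance helper, cf. ★
`ProjFrame.topCoord_congr`). [cite: Hartshorne1977, II Thm. 7.1 (a) (p. 150)] -/
theorem stdPos_congr {T' : Scheme.{0}} {ψ ψ' : Fin (Nat.card J + 2) → (T' ⟶ projectiveSpaceInt J)} (e : ψ = ψ')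
    (h : ∃ hx : ∀ j, preU (ψ j) (stdChart (Nat.card J) j) = ⊤,
      topCoord ψ (stdChart (Nat.card J)) hx = fundamentalFrame (Nat.card J) Γ(T', ⊤)) :
    ∃ hx : ∀ j, preU (ψ' j) (stdChart (Nat.card J) j) = ⊤,
      topCoord ψ' (stdChart (Nat.card J)) hx = fundamentalFrame (Nat.card J) Γ(T', ⊤) := by
  subst e
  exact h

include hV in
/-- **§2 Uniqueness (MFK Prop. 7.6 p. 137: «the morphism to the slice is unique»)**: two morphisms `v₁ v₂ : S → V` along
both of which `Q` is a pull-back of `univ|_V` are equal — the two induced linear rigidifications differ Zariski-locally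
by `M ∈ GL_{m+1}` (★ `exists_openCover_GL_of_isLinearRigidification`) fixing the standard position, so `M` is scalar and acts trivially; then `represents`
(★ `classifying_unique`) and `Mono jV`. [cite: MumfordFogartyKirwan1994, Ch. 7 §2 Proposition 7.6 (pp. 136–138)] -/
theorem sliceRepresents_unique ⦃S : Scheme.{0}⦄ [IsLocallyNoetherian S] (fS : S ⟶ Spec (.of ℚ))
    (Q : PolarizedAbelianSchemeWithLevel g N δ S) {v₁ v₂ : S ⟶ V}
    {G₁ G₂ : Q.A.X.left ⟶ (𝓗.univ.baseChange jV).A.X.left}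
    {Ĝ₁ Ĝ₂ : Q.D.hat.X.left ⟶ (𝓗.univ.baseChange jV).D.hat.X.left}
    (h₁ : Q.IsBaseChangeVia (𝓗.univ.baseChange jV) v₁ G₁ Ĝ₁)
    (h₂ : Q.IsBaseChangeVia (𝓗.univ.baseChange jV) v₂ G₂ Ĝ₂) : v₁ = v₂ := by
  haveI := 𝓗.isLocallyNoetherian
  have hk₁ := h₁.trans (𝓗.univ.baseChange_isBaseChangeVia jV)
  have hk₂ := h₂.trans (𝓗.univ.baseChange_isBaseChangeVia jV)
  have hκ₁ : Q.IsLinearRigidification J ((G₁ ≫ pullback.fst 𝓗.univ.A.X.hom jV) ≫ 𝓗.emb) :=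
    hk₁.isLinearRigidification_comp 𝓗.isLinearRigidification_emb
  have hκ₂ : Q.IsLinearRigidification J ((G₂ ≫ pullback.fst 𝓗.univ.A.X.hom jV) ≫ 𝓗.emb) :=
    hk₂.isLinearRigidification_comp 𝓗.isLinearRigidification_emb
  suffices hκ : (G₁ ≫ pullback.fst 𝓗.univ.A.X.hom jV) ≫ 𝓗.emb = (G₂ ≫ pullback.fst 𝓗.univ.A.X.hom jV) ≫ 𝓗.emb by
    haveI : IsLocallyNoetherian (Over.mk fS : SchemeOver ℚ).left := inferInstanceAs (IsLocallyNoetherian S)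
    have w₁ : (v₁ ≫ jV) ≫ 𝓗.H.hom = (Over.mk fS : SchemeOver ℚ).hom := hom_ext_specRat _ _
    have w₂ : (v₂ ≫ jV) ≫ 𝓗.H.hom = (Over.mk fS : SchemeOver ℚ).hom := hom_ext_specRat _ _
    have key := 𝓗.classifying_unique (Over.mk fS) Q _ hκ₁ (f₁ := Over.homMk (v₁ ≫ jV) w₁)
      (f₂ := Over.homMk (v₂ ≫ jV) w₂) hk₁ rfl hk₂ hκ.symm
    rw [← cancel_mono jV]
    exact congrArg CommaMorphism.left key
  -- Zariski-locally the two rigidifications differ by `M ∈ GL_{m+1}`; we show each `M` is scalar.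
  obtain ⟨𝒰, h𝒰⟩ := exists_openCover_GL_of_isLinearRigidification Q _ _ hκ₂ hκ₁
  refine Scheme.Cover.hom_ext (𝒰.pullback₁ Q.A.X.hom) _ _ fun (i : 𝒰.I₀) => ?_
  obtain ⟨M, hM⟩ := h𝒰 i
  letI : Algebra intU.{0} Γ(𝒰.X i, ⊤) := (intCast _).toAlgebra
  letI : Algebra intU.{0} Γ((Q.baseChange (𝒰.f i)).A.X.left, ⊤) := (intCast _).toAlgebra
  change pullback.fst Q.A.X.hom (𝒰.f i) ≫ _ = pullback.fst Q.A.X.hom (𝒰.f i) ≫ _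
  rw [hM]
  -- the two marked tuples over `𝒰.X i`
  have e : ∀ (v : S ⟶ V) (G : Q.A.X.left ⟶ (𝓗.univ.baseChange jV).A.X.left) (Ĝ)
      (_ : Q.IsBaseChangeVia 𝓗.univ (v ≫ jV) (G ≫ pullback.fst 𝓗.univ.A.X.hom jV) Ĝ),
      (fun j => (𝒰.f i ≫ v ≫ jV) ≫ 𝓗.markedPoint (R j)) = markedTuple J (Q.baseChange (𝒰.f i))
        (pullback.fst Q.A.X.hom (𝒰.f i) ≫ (G ≫ pullback.fst 𝓗.univ.A.X.hom jV) ≫ 𝓗.emb) R := by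
    intro v G Ĝ hk
    funext j
    rw [markedTuple_baseChange, markedTuple_apply, ← 𝓗.comp_markedPoint hk rfl (R j)]
    simp only [Category.assoc]
  obtain ⟨hx₂, hF₂⟩ := stdPos_congr (J := J) (e v₂ G₂ _ hk₂)
    (𝓗.exists_topCoord_comp_eq_fundamentalFrame R V jV hV v₂ (𝒰.f i))
  -- `ψ₁ = M • ψ₂`
  have eM : (fun j => (𝒰.f i ≫ v₁ ≫ jV) ≫ 𝓗.markedPoint (R j)) = fun j =>
      (isPullback_projToSpec_projMap_terminal J Γ(𝒰.X i, ⊤)).lift (𝒰.X i).toSpecΓ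
        (markedTuple J (Q.baseChange (𝒰.f i))
          (pullback.fst Q.A.X.hom (𝒰.f i) ≫ (G₂ ≫ pullback.fst 𝓗.univ.A.X.hom jV) ≫ 𝓗.emb) R j)
        (terminal.hom_ext _ _) ≫ actCore J M := by
    rw [e v₁ G₁ _ hk₁]
    funext j
    rw [← markedTuple_lift_actCore J (Q.baseChange (𝒰.f i)) _ R M j]
    exact congrArg (fun κ => markedTuple J (Q.baseChange (𝒰.f i)) κ R j) hM
  obtain ⟨hx₁, hF₁⟩ := stdPos_congr (J := J) eM (𝓗.exists_topCoord_comp_eq_fundamentalFrame R V jV hV v₁ (𝒰.f i))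
  obtain ⟨u, hu⟩ := exists_eq_scalar_of_topCoord_lift_actCore_eq_fundamentalFrame J _ hx₂ hF₂ M hx₁ hF₁
  refine lift_actCore_eq_self_of_eq_scalar J _ _
    (Units.map ((Q.baseChange (𝒰.f i)).A.X.hom.appTop.hom : Γ(𝒰.X i, ⊤) →+* _).toMonoidHom u) ?_
  rw [hu]
  apply Units.ext
  change ((Q.baseChange (𝒰.f i)).A.X.hom.appTop.hom : Γ(𝒰.X i, ⊤) →+* _).mapMatrix (Matrix.scalar _ (u : Γ(𝒰.X i, ⊤))) =
    Matrix.scalar _ _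
  rw [RingHom.mapMatrix_apply, Matrix.scalar_apply, Matrix.diagonal_map (map_zero _), Matrix.scalar_apply]
  rfl

omit [Mono jV] in
include hV in
/-- **§1 Local existence (MFK Prop. 7.6, Ch. 3 Prop. 3.1)**: a linearly rigidified triple whose `R`-marked points are a unit
frame in one chart choice is classified by the slice. [cite: MumfordFogartyKirwan1994, Ch. 7 §2 Proposition 7.6 (pp. 136–138)] -/
theorem sliceRepresents_local ⦃S : Scheme.{0}⦄ [IsLocallyNoetherian S] (fS : S ⟶ Spec (.of ℚ))
    (Q : PolarizedAbelianSchemeWithLevel g N δ S) (κ : Q.A.X.left ⟶ projectiveSpaceInt J)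
    (hκ : Q.IsLinearRigidification J κ) (c : Fin (Nat.card J + 2) → Fin (Nat.card J + 1))
    (hc : ∀ j, preU (markedTuple J Q κ R j) (c j) = ⊤) (hunit : IsUnitFrame (topCoord (markedTuple J Q κ R) c hc)) :
    ∃ (v : S ⟶ V) (G : Q.A.X.left ⟶ (𝓗.univ.baseChange jV).A.X.left)
      (Ĝ : Q.D.hat.X.left ⟶ (𝓗.univ.baseChange jV).D.hat.X.left), Q.IsBaseChangeVia (𝓗.univ.baseChange jV) v G Ĝ := by
  letI : Algebra intU.{0} Γ(S, ⊤) := (intCast _).toAlgebra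
  letI : Algebra intU.{0} Γ(Q.A.X.left, ⊤) := (intCast _).toAlgebra
  have hstd := topCoord_lift_actCore_transporterGL_inv J (markedTuple J Q κ R) c hc hunit
  set M := (transporterGL (topCoord (markedTuple J Q κ R) c hc) hunit)⁻¹ with hM
  have hκ' := hκ.lift_actCore J M
  set κ' := (isPullback_projToSpec_projMap_terminal J Γ(Q.A.X.left, ⊤)).lift Q.A.X.left.toSpecΓ κ
      (terminal.hom_ext _ _) ≫ actCore J (Matrix.GeneralLinearGroup.map Q.A.X.hom.appTop.hom M) with hκ'def
  haveI : IsLocallyNoetherian (Over.mk fS : SchemeOver ℚ).left := inferInstanceAs (IsLocallyNoetherian S)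
  obtain ⟨G₀, Ĝ₀, hf, hG₀⟩ := 𝓗.exists_isBaseChangeVia_classifyingMap (Over.mk fS) Q κ' hκ'
  have hx : (fun j => (𝓗.classifyingMap (Over.mk fS) Q κ' hκ').left ≫ 𝓗.markedPoint (R j)) = fun j =>
      (isPullback_projToSpec_projMap_terminal J Γ(S, ⊤)).lift S.toSpecΓ (markedTuple J Q κ R j)
        (terminal.hom_ext _ _) ≫ actCore J M := by
    funext j
    rw [𝓗.comp_markedPoint hf hG₀ (R j), ← markedTuple_apply, hκ'def]
    exact markedTuple_lift_actCore J Q κ R M j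
  have key : ∀ ψ : Fin (Nat.card J + 2) → (S ⟶ projectiveSpaceInt J), ψ = (fun j =>
      (isPullback_projToSpec_projMap_terminal J Γ(S, ⊤)).lift S.toSpecΓ (markedTuple J Q κ R j)
        (terminal.hom_ext _ _) ≫ actCore J M) →
      ∃ hx : ∀ j, preU (ψ j) (stdChart (Nat.card J) j) = ⊤,
        topCoord ψ (stdChart (Nat.card J)) hx = fundamentalFrame (Nat.card J) Γ(S, ⊤) := by
    rintro _ rfl
    exact ⟨_, hstd⟩
  obtain ⟨v, hv⟩ := (hV (𝓗.classifyingMap (Over.mk fS) Q κ' hκ').left).mpr (key _ hx)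
  rw [← hv] at hf
  obtain ⟨m, mh, -, -, hrel⟩ := exists_isBaseChangeVia_of_comp hf (𝓗.univ.baseChange_isBaseChangeVia jV)
  exact ⟨v, m, mh, hrel⟩

omit [Mono jV] in
include hV in
/-- **§3a Local classification at a point of `𝓕_R`**: every point of a triple in `𝓕_R(T)` has an open neighbourhood
`i : U ↪ T` over which `P'|_U` is classified by the slice (unfold `frameOpen`, shrink to one chart choice with unit frame
determinant — ★ `isUnitFrame_topCoord_basicOpen` — and apply §1). [cite: MumfordFogartyKirwan1994, Ch. 7 §2 Proposition 7.6 (pp. 136–138)] -/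
theorem exists_nhd_isBaseChangeVia_slice ⦃T : Scheme.{0}⦄ [IsLocallyNoetherian T] (fT : T ⟶ Spec (.of ℚ))
    (P' : PolarizedAbelianSchemeWithLevel g N δ T) (hP' : IsFrameOn J P' R) (t : T) :
    ∃ (U : Scheme.{0}) (i : U ⟶ T) (_ : IsOpenImmersion i) (_ : t ∈ Set.range i.base) (w : U ⟶ V)
      (G : (P'.baseChange i).A.X.left ⟶ (𝓗.univ.baseChange jV).A.X.left)
      (Ĝ : (P'.baseChange i).D.hat.X.left ⟶ (𝓗.univ.baseChange jV).D.hat.X.left),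
      (P'.baseChange i).IsBaseChangeVia (𝓗.univ.baseChange jV) w G Ĝ := by
  have ht : t ∈ frameOpen J P' R := by rw [(isFrameOn_iff J P' R).mp hP']; trivial
  simp only [frameOpen, Opens.mem_iSup] at ht
  obtain ⟨U₀, ι, hι, htU⟩ := ht
  rw [← SetLike.mem_coe, Scheme.Hom.coe_image] at htU
  obtain ⟨s, hs, hst⟩ := htU
  obtain ⟨c, hsc⟩ := (mem_frameLocus_iff _ s).mp hs
  -- the piece: the basic open of the frame determinant in the chart choice `c`
  set φ := markedTuple J (P'.baseChange U₀.ι) ι R with hφ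
  set W : (U₀ : Scheme.{0}).Opens := (U₀ : Scheme.{0}).basicOpen (frameDetSection φ c) with hW
  have hcψ := preU_ι_comp_eq_top φ c (basicOpen_frameDetSection_le_chartOpen φ c)
  have hunitψ := isUnitFrame_topCoord_basicOpen φ c
  have e : (fun j => W.ι ≫ φ j) = markedTuple J ((P'.baseChange U₀.ι).baseChange W.ι)
      (pullback.fst (P'.baseChange U₀.ι).A.X.hom W.ι ≫ ι) R :=
    funext fun j => (markedTuple_baseChange J _ ι R W.ι j).symm
  have key : ∀ ψ, (fun j => W.ι ≫ φ j) = ψ → ∃ hc : ∀ j, preU (ψ j) (c j) = ⊤, IsUnitFrame (topCoord ψ c hc) := by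
    rintro _ rfl
    exact ⟨hcψ, hunitψ⟩
  obtain ⟨hc, hunit⟩ := key _ e
  obtain ⟨w, G, Ĝ, hrel⟩ := 𝓗.sliceRepresents_local R V jV hV ((W.ι ≫ U₀.ι) ≫ fT) _ _ (hι.baseChange W.ι) c hc hunit
  -- move the relation onto `P'.baseChange (W.ι ≫ U₀.ι)`
  have h₂ : ((P'.baseChange U₀.ι).baseChange W.ι).IsBaseChangeVia P' (W.ι ≫ U₀.ι) _ _ :=
    ((P'.baseChange U₀.ι).baseChange_isBaseChangeVia W.ι).trans (P'.baseChange_isBaseChangeVia U₀.ι)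
  have h₁ : (P'.baseChange (W.ι ≫ U₀.ι)).IsBaseChangeVia P' (𝟙 _ ≫ W.ι ≫ U₀.ι)
      (pullback.fst P'.A.X.hom (W.ι ≫ U₀.ι)) (pullback.fst P'.D.hat.X.hom (W.ι ≫ U₀.ι)) := by
    rw [Category.id_comp]; exact P'.baseChange_isBaseChangeVia (W.ι ≫ U₀.ι)
  obtain ⟨m, mh, -, -, hm⟩ := exists_isBaseChangeVia_of_comp h₁ h₂
  have hfin := hm.trans hrel
  rw [Category.id_comp] at hfin
  exact ⟨W, W.ι ≫ U₀.ι, inferInstance, ⟨⟨s, hsc⟩, by simpa using hst⟩, w, m ≫ G, mh ≫ Ĝ, hfin⟩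

include hN hV in
/-- **The standard-frame slice represents the frame sub-functor `𝓕_R`** (MFK Prop. 7.6, pp. 136–138, with Ch. 3 §1
Prop. 3.1): for a level `N ≥ 3` and a sub-scheme `jV : V ↪ H` of the covariant whose `T'`-points are exactly the
`T'`-points of `H` with `R`-marked points in standard position (`hV`), every triple `P'` over a locally Noetherian
`ℚ`-scheme `T` lying in `𝓕_R(T)` (`IsFrameOn J P' R`) is the pull-back of `univ|_V` along a UNIQUE `v : T → V`.
Existence: §3a at every point, the local morphisms agree on overlaps by §2 and glue (Mathlib `Scheme.Cover.glueMorphisms`),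
the relation glues by ★ `exists_isBaseChangeVia_of_openCover` (field rigidity from ★ `eq_id_and_hat_eq_id_of_three_le`,
this is where `3 ≤ N` and the `ℚ`-structure enter); uniqueness: §2 (two linear rigidifications differ Zariski-locally by `GL_{m+1}`:
★ `exists_openCover_GL_of_isLinearRigidification`, (U-b) of the F-8 chain).
[cite: MumfordFogartyKirwan1994, Ch. 7 §2 Proposition 7.6 (pp. 136–138)] [cite: MumfordFogartyKirwan1994, Ch. 3 §1 Proposition 3.1] -/
theorem sliceRepresents ⦃T : Scheme.{0}⦄ [IsLocallyNoetherian T] (_fT : T ⟶ Spec (.of ℚ))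
    (P' : PolarizedAbelianSchemeWithLevel g N δ T) (hP' : IsFrameOn J P' R) :
    ∃! v : T ⟶ V, ∃ (G : P'.A.X.left ⟶ (𝓗.univ.baseChange jV).A.X.left)
      (Ĝ : P'.D.hat.X.left ⟶ (𝓗.univ.baseChange jV).D.hat.X.left), P'.IsBaseChangeVia (𝓗.univ.baseChange jV) v G Ĝ := by
  choose U i hi hti w Gc Ĝc hloc using 𝓗.exists_nhd_isBaseChangeVia_slice R V jV hV _fT P' hP'
  let 𝒰 : T.OpenCover :=
    Scheme.Cover.mkOfCovers (P := @IsOpenImmersion) T U i (fun t => ⟨t, (hti t).choose, (hti t).choose_spec⟩) hi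
  have hloc' : ∀ t, (P'.baseChange (𝒰.f t)).IsBaseChangeVia (𝓗.univ.baseChange jV) (w t) (Gc t) (Ĝc t) := hloc
  -- the local morphisms agree on overlaps (§2 over `U_s ×_T U_t`)
  have hcompat : ∀ s t, pullback.fst (𝒰.f s) (𝒰.f t) ≫ w s = pullback.snd (𝒰.f s) (𝒰.f t) ≫ w t := by
    intro s t
    haveI : IsLocallyNoetherian (pullback (𝒰.f s) (𝒰.f t)) :=
      isLocallyNoetherian_of_isOpenImmersion (pullback.fst (𝒰.f s) (𝒰.f t) ≫ 𝒰.f s)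
    have hQ := P'.baseChange_isBaseChangeVia (pullback.fst (𝒰.f s) (𝒰.f t) ≫ 𝒰.f s)
    obtain ⟨m₁, mh₁, -, -, r₁⟩ := exists_isBaseChangeVia_of_comp hQ (P'.baseChange_isBaseChangeVia (𝒰.f s))
    have hQ' : (P'.baseChange (pullback.fst (𝒰.f s) (𝒰.f t) ≫ 𝒰.f s)).IsBaseChangeVia P'
        (pullback.snd (𝒰.f s) (𝒰.f t) ≫ 𝒰.f t) (pullback.fst P'.A.X.hom (pullback.fst (𝒰.f s) (𝒰.f t) ≫ 𝒰.f s))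
        (pullback.fst P'.D.hat.X.hom (pullback.fst (𝒰.f s) (𝒰.f t) ≫ 𝒰.f s)) := by
      rw [← pullback.condition]; exact hQ
    obtain ⟨m₂, mh₂, -, -, r₂⟩ := exists_isBaseChangeVia_of_comp hQ' (P'.baseChange_isBaseChangeVia (𝒰.f t))
    exact 𝓗.sliceRepresents_unique R V jV hV ((pullback.fst (𝒰.f s) (𝒰.f t) ≫ 𝒰.f s) ≫ _fT) _
      (r₁.trans (hloc' s)) (r₂.trans (hloc' t))
  -- glue the morphisms and the relation
  have hT : ∀ ⦃Ω : Type⦄ [Field Ω] [IsAlgClosed Ω] (_x : Spec (.of Ω) ⟶ T)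
      (Q : PolarizedAbelianSchemeWithLevel g N δ (Spec (.of Ω))) (H : Q.A.X.left ⟶ Q.A.X.left)
      (Ĥ : Q.D.hat.X.left ⟶ Q.D.hat.X.left), Q.IsBaseChangeVia Q (𝟙 _) H Ĥ → H = 𝟙 _ :=
    fun Ω _ _ x Q H Ĥ h => (eq_id_and_hat_eq_id_of_three_le (x ≫ _fT) hN Q h).1
  obtain ⟨G, Ĝ, -, -, hrel⟩ := exists_isBaseChangeVia_of_openCover (f := 𝒰.glueMorphisms w hcompat) hT 𝒰 Gc Ĝc
    (fun t => by rw [Scheme.Cover.ι_glueMorphisms]; exact hloc' t)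
  exact ⟨𝒰.glueMorphisms w hcompat, ⟨G, Ĝ, hrel⟩,
    fun v' ⟨G', Ĝ', h'⟩ => 𝓗.sliceRepresents_unique R V jV hV _fT P' h' hrel⟩


omit [Mono jV] in
include hV in
/-- **`univ|_V ∈ 𝓕_R(V)`** (the `huniv` input of the (8ε) assembly): through the restricted universal rigidification
`X|_V → X → 𝐏^m` the `R`-marked points of `univ|_V` are `jV ≫` the universal marked points, in standard position by `hV`
at `𝟙_V`, hence a frame everywhere (★ `frameLocus_eq_top_iff_isUnitFrame`), and the frame locus of any linear
rigidification lies in `U_R` (★ `frameLocus_le_frameOpen`). [cite: MumfordFogartyKirwan1994, Ch. 7 §2 Proposition 7.6 (pp. 136–138)]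
[cite: MumfordFogartyKirwan1994, Ch. 3 §1 Definition 3.3 (p. 68)] -/
theorem isFrameOn_univ_baseChange [IsLocallyNoetherian V] : IsFrameOn J (𝓗.univ.baseChange jV) R := by
  haveI := 𝓗.isLocallyNoetherian
  have hι := 𝓗.isLinearRigidification_emb.baseChange jV
  rw [isFrameOn_iff]
  refine top_le_iff.mp (le_trans (eq_top_iff.mp ?_) (frameLocus_le_frameOpen J R hι))
  have e : (fun j => (𝟙 V ≫ 𝟙 V ≫ jV) ≫ 𝓗.markedPoint (R j)) =
      markedTuple J (𝓗.univ.baseChange jV) (pullback.fst 𝓗.univ.A.X.hom jV ≫ 𝓗.emb) R := by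
    funext j
    rw [markedTuple_baseChange, markedPoint_def, markedTuple_apply, Category.id_comp, Category.id_comp]
  obtain ⟨hx, hF⟩ := stdPos_congr (J := J) e (𝓗.exists_topCoord_comp_eq_fundamentalFrame R V jV hV (𝟙 V) (𝟙 V))
  exact (frameLocus_eq_top_iff_isUnitFrame _ (stdChart (Nat.card J)) hx).mpr (hF ▸ isUnitFrame_fundamentalFrame)

end Generic

/-! ## §4 The concrete slice `V_R = σ_R⁻¹(standard frame) ⊂ W_R ⊂ H` (MFK Ch. 3 §1 Prop. 3.1) -/

section Slice

variable (R : Fin (Nat.card J + 2) → (Fin g ⊕ Fin g → ZMod N))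

/-- On `W_R := H_{D(R)}` — the basic open of the frame determinant of the universal `R`-marked points in the STANDARD
chart choice — every marked point lies in its standard chart (★ `preU_ι_comp_eq_top`).
[cite: MumfordFogartyKirwan1994, Ch. 3 §1 Proposition 3.1] -/
theorem preU_ι_markedTuple_stdChart_eq_top (j : Fin (Nat.card J + 2)) :
    preU ((𝓗.H.left.basicOpen (frameDetSection (markedTuple J 𝓗.univ 𝓗.emb R) (stdChart (Nat.card J)))).ι ≫
      markedTuple J 𝓗.univ 𝓗.emb R j) (stdChart (Nat.card J) j) = ⊤ :=
  preU_ι_comp_eq_top _ _ (basicOpen_frameDetSection_le_chartOpen _ _) j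

/-- **The standard-frame slice is locally Noetherian** (a closed sub-scheme of an open of the locally Noetherian `H`).
[cite: MumfordFogartyKirwan1994, Ch. 7 §2 Proposition 7.6 (pp. 136–138)] -/
theorem isLocallyNoetherian_slice :
    IsLocallyNoetherian (slice (fun j =>
      (𝓗.H.left.basicOpen (frameDetSection (markedTuple J 𝓗.univ 𝓗.emb R) (stdChart (Nat.card J)))).ι ≫
        markedTuple J 𝓗.univ 𝓗.emb R j) (stdChart (Nat.card J)) (𝓗.preU_ι_markedTuple_stdChart_eq_top R)) := by
  haveI := 𝓗.isLocallyNoetherian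
  exact LocallyOfFiniteType.isLocallyNoetherian (sliceι _ _ (𝓗.preU_ι_markedTuple_stdChart_eq_top R) ≫
    (𝓗.H.left.basicOpen (frameDetSection (markedTuple J 𝓗.univ 𝓗.emb R) (stdChart (Nat.card J)))).ι)

/-- **`T'`-points of the slice** (`hV` of `sliceRepresents`): a morphism `x : T' → H` factors through
`V_R ↪ W_R ↪ H` iff the `R`-marked points of `x` are in standard position (★ `comp_sliceι_factors_iff`; the
factorisation through `W_R` is automatic since a tuple in standard position has unit frame determinant,
★ `frameLocus_eq_basicOpen` + `preimage_basicOpen_frameDetSection`). [cite: MumfordFogartyKirwan1994, Ch. 3 §1 Proposition 3.1] -/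
theorem exists_comp_sliceι_eq_iff {T' : Scheme.{0}} (x : T' ⟶ 𝓗.H.left) :
    (∃ y : T' ⟶ slice (fun j =>
        (𝓗.H.left.basicOpen (frameDetSection (markedTuple J 𝓗.univ 𝓗.emb R) (stdChart (Nat.card J)))).ι ≫
          markedTuple J 𝓗.univ 𝓗.emb R j) (stdChart (Nat.card J)) (𝓗.preU_ι_markedTuple_stdChart_eq_top R),
      y ≫ (sliceι _ _ (𝓗.preU_ι_markedTuple_stdChart_eq_top R) ≫
        (𝓗.H.left.basicOpen (frameDetSection (markedTuple J 𝓗.univ 𝓗.emb R) (stdChart (Nat.card J)))).ι) = x) ↔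
    ∃ hx : ∀ j, preU (x ≫ 𝓗.markedPoint (R j)) (stdChart (Nat.card J) j) = ⊤,
      topCoord (fun j => x ≫ 𝓗.markedPoint (R j)) (stdChart (Nat.card J)) hx =
        fundamentalFrame (Nat.card J) Γ(T', ⊤) := by
  set φ := markedTuple J 𝓗.univ 𝓗.emb R with hφ
  set W := 𝓗.H.left.basicOpen (frameDetSection φ (stdChart (Nat.card J))) with hW
  have hmk : ∀ j, 𝓗.markedPoint (R j) = φ j := fun j => by rw [markedPoint_def, hφ, markedTuple_apply]
  constructor
  · rintro ⟨y, rfl⟩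
    have h := (comp_sliceι_factors_iff (fun j => W.ι ≫ φ j) (stdChart (Nat.card J))
      (𝓗.preU_ι_markedTuple_stdChart_eq_top R) (y ≫ sliceι _ _ _)).mp ⟨y, rfl⟩
    have e : (fun j => (y ≫ sliceι _ _ (𝓗.preU_ι_markedTuple_stdChart_eq_top R)) ≫ W.ι ≫ φ j) =
        fun j => (y ≫ sliceι _ _ (𝓗.preU_ι_markedTuple_stdChart_eq_top R) ≫ W.ι) ≫ 𝓗.markedPoint (R j) := by
      funext j; rw [hmk]; simp only [Category.assoc]
    exact stdPos_congr (J := J) e ⟨_, h⟩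
  · rintro ⟨hx, hF⟩
    -- `x` lands in `W`: the pulled-back tuple has unit frame determinant in the standard charts
    have hxW : x ⁻¹ᵁ W = ⊤ := by
      rw [hW, preimage_basicOpen_frameDetSection, ← frameLocus_eq_basicOpen _ _ (by
        intro j; rw [← hmk]; exact hx j)]
      exact (frameLocus_eq_top_iff_isUnitFrame _ (stdChart (Nat.card J)) (by intro j; rw [← hmk]; exact hx j)).mpr
        (by rw [topCoord_congr (stdChart (Nat.card J)) (funext fun j => (hmk j).symm ▸ rfl) _ hx, hF]
            exact isUnitFrame_fundamentalFrame)
    have hrange : Set.range x.base ⊆ Set.range W.ι.base := by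
      rw [Scheme.Opens.range_ι]
      rintro _ ⟨p, rfl⟩
      have : p ∈ x ⁻¹ᵁ W := by rw [hxW]; trivial
      exact this
    set x₀ := IsOpenImmersion.lift W.ι x hrange with hx₀
    have hx₀W : x₀ ≫ W.ι = x := IsOpenImmersion.lift_fac W.ι x hrange
    have e : (fun j => x ≫ 𝓗.markedPoint (R j)) = fun j => x₀ ≫ W.ι ≫ φ j := by
      funext j; rw [hmk, ← hx₀W, Category.assoc]
    obtain ⟨y, hy⟩ := (comp_sliceι_factors_iff (fun j => W.ι ≫ φ j) (stdChart (Nat.card J))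
      (𝓗.preU_ι_markedTuple_stdChart_eq_top R) x₀).mpr (by
        rw [← topCoord_congr (stdChart (Nat.card J)) e hx, hF])
    exact ⟨y, by rw [← Category.assoc, hy, hx₀W]⟩

/-- **The slice `V_R` represents `𝓕_R`** — `sliceRepresents` at the concrete standard-frame slice of `H`
(the `hrep` input of ★ `SiegelFineModuliScheme.classify_of_openCharts`, with `V R := slice`, `j` to be the glued chart,
`ZV R := univ|_{V_R}`). [cite: MumfordFogartyKirwan1994, Ch. 7 §2 Proposition 7.6 (pp. 136–138)]
[cite: MumfordFogartyKirwan1994, Ch. 3 §1 Proposition 3.1] -/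
theorem sliceRepresents_slice (hN : 3 ≤ N)
    ⦃T : Scheme.{0}⦄ [IsLocallyNoetherian T] (fT : T ⟶ Spec (.of ℚ))
    (P' : PolarizedAbelianSchemeWithLevel g N δ T) (hP' : IsFrameOn J P' R) :
    ∃! v : T ⟶ slice (fun j =>
        (𝓗.H.left.basicOpen (frameDetSection (markedTuple J 𝓗.univ 𝓗.emb R) (stdChart (Nat.card J)))).ι ≫
          markedTuple J 𝓗.univ 𝓗.emb R j) (stdChart (Nat.card J)) (𝓗.preU_ι_markedTuple_stdChart_eq_top R),
      ∃ (G : P'.A.X.left ⟶ (𝓗.univ.baseChange (sliceι _ _ (𝓗.preU_ι_markedTuple_stdChart_eq_top R) ≫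
          (𝓗.H.left.basicOpen (frameDetSection (markedTuple J 𝓗.univ 𝓗.emb R) (stdChart (Nat.card J)))).ι)).A.X.left)
        (Ĝ : P'.D.hat.X.left ⟶ (𝓗.univ.baseChange (sliceι _ _ (𝓗.preU_ι_markedTuple_stdChart_eq_top R) ≫
          (𝓗.H.left.basicOpen (frameDetSection (markedTuple J 𝓗.univ 𝓗.emb R) (stdChart (Nat.card J)))).ι)).D.hat.X.left),
        P'.IsBaseChangeVia (𝓗.univ.baseChange (sliceι _ _ (𝓗.preU_ι_markedTuple_stdChart_eq_top R) ≫
          (𝓗.H.left.basicOpen (frameDetSection (markedTuple J 𝓗.univ 𝓗.emb R) (stdChart (Nat.card J)))).ι)) v G Ĝ :=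
  𝓗.sliceRepresents hN R _ _ (fun _ x => 𝓗.exists_comp_sliceι_eq_iff R x) fT P' hP'

/-- **`univ|_{V_R} ∈ 𝓕_R(V_R)`** for the concrete standard-frame slice (the `huniv R` input of the (8ε) assembly).
[cite: MumfordFogartyKirwan1994, Ch. 7 §2 Proposition 7.6 (pp. 136–138)] -/
theorem isFrameOn_univ_baseChange_slice :
    IsFrameOn J (𝓗.univ.baseChange (sliceι _ _ (𝓗.preU_ι_markedTuple_stdChart_eq_top R) ≫
      (𝓗.H.left.basicOpen (frameDetSection (markedTuple J 𝓗.univ 𝓗.emb R) (stdChart (Nat.card J)))).ι)) R :=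
  haveI := 𝓗.isLocallyNoetherian_slice R
  𝓗.isFrameOn_univ_baseChange R _ _ (fun _ x => 𝓗.exists_comp_sliceι_eq_iff R x)

end Slice

end SiegelFramedCovariant

end Literature.AlgebraicGeometry.ModuliOfAbelianVarieties

end
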